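import Literature.Computability.Cryptography.RegevReductionCVPqWrapperLaws
import Literature.Computability.Cryptography.RegevReductionCVPqBlockCoins
import Literature.Computability.Cryptography.RegevReductionCVPqSamplerSplit
import Literature.Computability.Complexity.PairingMachines
import Literature.Computability.Complexity.StringCopy
import HarnessLib

/-!
# Regev's CVP_q machine (Lemma 3.11): the plumbing fact A_plumb PROVED from two classical programs

HONEST FRAMING. This file is part of a first formalisation of a KNOWN reduction (Regev 2009,
worst-case GapSVP/SIVP ≤ LWE, classical part). Its value is a THEOREM about that reduction — the
named fact `regev2009_lemma_3_11_cvpqPlumbing` ("A_plumb": a uniform polynomial-time quantum oracle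
machine realising the exact law `condExpS` of Regev's CVP_q procedure built around an LWE solver `W`)
is reduced to the existence of TWO CLASSICAL POLYNOMIAL-TIME STRING FUNCTIONS with stated input/output
behaviour. It is NOT progress on any open problem and breaks nothing.

## What is proved

`Regev2009.CVPqPrograms q α m a samp pc W` (a `structure`, used as a HYPOTHESIS — no named fact is
introduced) packages, for one parameter set and one solver `W`:
* `manuf ∈ FP` — the *block manufacture*: on `(x ++ e_j) ++ c` (the oracle query `x` of Regev's
  procedure, the unary index `e_j` of a block, `|c| = p_coin(|x| + |e_j|)` coin bits) it writes the LWE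
  code of block `j`'s shifted samples, i.e. `blockInput … j c` — the deterministic function of the coins
  whose law under uniform coins is `condBlockDataG … j` (module `RegevReductionCVPqBlockCoins`);
* `post P ∈ FP` — the *post-processing*, for every polynomial layout `P` of indexed copies with index
  polynomial `pK`: on `⟨x, y⟩` it writes the digit table of the first accepted candidate
  (`firstAcceptedK ∘ accTest`, exact rational readout) computed from the `nBlk = (24m+2)(n+1)` block
  results read off the width-`b` blocks of `y`;
* two polynomial bounds (`nBlk ≤ pK(|x|) + 1`, coins of a block `≤ p_coin(|x| + pK(|x|) + 1)`).

From these, with NO further hypothesis: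
* `Regev2009.cvpqMachine_law_of_programs` — the uniform family
  `T := CWrap(post) ∘ PolyCopiesIdx ∘ CoinCWrap(manuf, tag) ∘ W` satisfies, on every query string, the
  EXACT law: its first `n·size q` output bits are distributed as `(condExpS …).map optTable`;
* `regev2009_lemma_3_11_cvpqPlumbing_of_programs` — hence A_plumb holds (with negligible slack `ν = 0`).

The assembly uses only previously landed, fully proved modules: the wrapper laws in
`UniformQCircuitFamily` form (`RegevReductionCVPqWrapperLaws`: classical pre- and post-processing around
a quantum subroutine, fresh uniform coins, indexed parallel copies), the exact coin law of one block
(`RegevReductionCVPqBlockCoins.uniformVector_bind_blockOfBits_withAnswer`) and the definitional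
unfolding `condExpS = (indepLaw nBlk (condBlockDataG j >>= withAnswer W)).map firstAcceptedK`
(`RegevReductionCVPqStability`, `RegevReductionCVPqSamplerSplit`). Two support facts make the
post-processing's specification depend on the polynomial layout only (not on the block family's ancilla
count): every segment of an output of the copies is an output of the block family
(`PolyCopiesIdx.kernel_map_segments`), and every output of the block family begins with the
self-delimiting tag `⟨⟨x', c⟩, y_W⟩, ε⟩`, so a reader of the whole width-`b` block recovers the same data.

## What remains (stated precisely, for the record)

After this file the trust base of `pqc.S19` (Regev's main theorem as stated in `LWEHardness`) is
`{A_plumb, A_q14}` with A_plumb ⇐ `Nonempty (CVPqPrograms …)` for all admissible parameters: i.e. the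
CONSTRUCTION of the two programs as `BitBrick.Prog`/`CodeFP` machines (parsing the query code, exact
rational arithmetic for `decodeIntD`, `shiftSample`, `cosReadout`/`thresholdReadout`, calls to the sampler
program `samp`) and the two polynomial bounds. Nothing here claims that construction.

## Sources

Regev 2009 (J. ACM 56(6):34; page numbers from arXiv:2401.03703): Lemma 3.11 p. 18 (the CVP_q procedure
given an LWE oracle: "efficient", `poly(n)` calls on independent sample batches), Lemma 3.7 p. 16
(verification by the cosine test), §3.2.1, Thm 3.1 p. 13. Bernstein–Vazirani 1997 §8 / Thm 8.3 and
Bennett–Bernstein–Brassard–Vazirani 1997 Thms 4.13–4.14 (composing uniform quantum machines with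
classical polynomial-time pre- and post-processing; parallel copies). Nielsen–Chuang 2010 §2.2.8
(statistics of product states), §4.4 (measurement). Goldreich 2001 §3.2.1 and Arora–Barak 2009 §0.1,
§1.4.1 (string functions, pair codes, FP closure under composition).
-/

noncomputable section

open Finset Module MeasureTheory Filter
open scoped ENNReal

namespace Literature.Computability.Cryptography

namespace Regev2009

open _root_.Computability Literature.Computability.Complexity Literature.Computability.Complexity.Brick
  Literature.Computability.QuantumComplexity Literature.Algebra.EuclideanLattices
  Literature.Probability.Distributions LWE Peikert2009 DigitOracle

/-! ### A self-delimiting tag and what a reader recovers from it -/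

/-- The self-delimiting tag of a word: `z ↦ ⟨z, ε⟩` (pair code with empty second field), so that `z` is
read back off ANY extension `⟨z, ε⟩ ++ junk = ⟨z, junk⟩`. [cite: AroraBarak2009, §0.1 (pair codes)] -/
def tagNil (z : List Bool) : List Bool := boolPair z []

/-- `⟨z, ε⟩ ++ r = ⟨z, r⟩`. [folklore] -/
theorem tagNil_append (z r : List Bool) : tagNil z ++ r = boolPair z r := by
  simp [tagNil, boolPair]

/-- The tagged word is read back off any extension. [folklore] -/
theorem fstF_of_tagNil_prefix {z w : List Bool} (h : tagNil z <+: w) : fstF w = z := by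
  obtain ⟨r, rfl⟩ := h
  rw [tagNil_append, fstF_boolPair]

/-- The tag is polynomial-time (`rePair ∘ dup`). [cite: AroraBarak2009, §1.4.1] -/
theorem tagNil_mem_FP : tagNil ∈ FP := by
  have : tagNil = rePair ∘ StrCopy.dup := funext fun z => (StrCopy.rePair_dup z).symm
  rw [this]
  exact comp_mem_FP rePair_mem_FP StrCopy.dup_mem_FP

/-! ### Uniform coins: function register versus bit vector -/

/-- `U({0,1}^C)` as functions `Fin C → Bool` read as lists IS `U` on bit vectors read as lists. [folklore] -/
theorem uniformQReg_bind_ofFn {β : Type} (C : ℕ) (f : List Bool → PMF β) :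
    (PMF.uniformOfFintype (QReg C)).bind (fun c => f (List.ofFn c)) =
      (PMF.uniformOfFintype (List.Vector Bool C)).bind fun r => f r.toList := by
  rw [← PMF.uniformOfFintype_map_equiv (Equiv.vectorEquivFin Bool C).symm, PMF.bind_map]
  refine congrArg ((PMF.uniformOfFintype (QReg C)).bind ·) (funext fun c => ?_)
  simp [Equiv.vectorEquivFin]

/-- `(l₁ ++ l₂).take |l₁| = l₁`. [folklore] -/
theorem take_length_append (l₁ l₂ : List Bool) : (l₁ ++ l₂).take l₁.length = l₁ := by
  induction l₁ with
  | nil => simp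
  | cons b l ih => simp [ih]

/-- `(l₁ ++ l₂).drop |l₁| = l₂`. [folklore] -/
theorem drop_length_append (l₁ l₂ : List Bool) : (l₁ ++ l₂).drop l₁.length = l₂ := by
  induction l₁ with
  | nil => simp
  | cons b l ih => simp [ih]

/-! ### The instance's block programs: what the manufacture must write and what a reader gets back -/

section Instance

variable (q : ℕ → ℕ) [∀ n, NeZero (q n)] (α : ℕ → ℝ) (m : ℕ → ℕ) (a : ℕ → ℚ)
  (samp : List Bool → List Bool) (pc : Polynomial ℕ)

/-- The number of blocks of the experiment in dimension `n`: `(K_g + 1) · J = (24 m + 2)(n + 1)`.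
[cite: RegevLWE2009, Lemma 3.7 (proof)] -/
def nBlk (n : ℕ) : ℕ := (nLevels (m n) + 1) * schedJ n

/-- There is at least one block. [folklore] -/
theorem nBlk_pos (n : ℕ) : 0 < nBlk m n :=
  Nat.mul_pos (Nat.succ_pos _) (by unfold schedJ; omega)

/-- **Block `j`'s data manufactured from a coin word `r`** (module 5's `blockOfBits` with the
instance's parameters, exactly those of `DigitOracle.condExpS`): shift from the first
`(size q + n)·n` coins, `m` coarse samples from the block's first `m` batch vectors with noise
`samp(⟨q N₀(t), padVar_j, 1ⁿ⟩, chunk)`, `N_V` fine samples likewise at modulus `512 q N₀(t)`,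
variance `a²/2`. [cite: RegevLWE2009, Lemma 3.11 (proof, Eq. (10)) with Lemma 3.7 (proof)] -/
def blockData (I : LatticeInstance) (hI : I.IsNonsingular) (t : Fin I.n → ℚ) {P : ℕ}
    (w : Fin P → I.lattice) (hP : nVectors (m I.n) I.n ≤ P) (j : Fin (nBlk m I.n)) (r : List Bool) :
    ((Fin I.n → ZMod (q I.n)) × (Fin (m I.n) → (Fin I.n → ZMod (q I.n)) × ZMod (q I.n))) ×
      (Fin (nVerify I.n) → (Fin I.n → ZMod (q I.n)) × ZMod (q I.n * schedK)) :=
  haveI := I.isZLattice_of_isNonsingular hI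
  blockOfBits (zBasis I) (q I.n) schedK (m I.n) (nVerify I.n) samp pc (q I.n * denom t)
    (padVar (a I.n) (nLevels (m I.n)) (schedJ I.n) j) I.n (q I.n * schedK * denom t) ((a I.n) ^ 2 / 2) I.n
    (Nat.size (q I.n) + I.n) (denom t) (numZ I t)
    (blocksOf (nBlk m I.n) (m I.n + nVerify I.n) (fun i => w (Fin.castLE hP i)) j) r

/-- **The oracle input of block `j`**: the code of the SHIFTED coarse batch `(aᵢ + … , bᵢ + ⟨aᵢ, s⟩)`.
[cite: RegevLWE2009, Lemma 3.7 (proof) with Lemma 4.1 (proof: "the unknown s is shifted")] -/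
def blockInput (I : LatticeInstance) (hI : I.IsNonsingular) (t : Fin I.n → ℚ) {P : ℕ}
    (w : Fin P → I.lattice) (hP : nVectors (m I.n) I.n ≤ P) (j : Fin (nBlk m I.n)) (r : List Bool) :
    List Bool :=
  encodeLWESamples (shiftSample (blockData q m a samp pc I hI t w hP j r).1.1 ∘
    (blockData q m a samp pc I hI t w hP j r).1.2)

/-- **Block `j`'s result** given the oracle's output register `y`: the data with the decoded answer
inserted (the deterministic part of `withAnswer`). [cite: RegevLWE2009, Lemma 3.7 (proof)] -/
def blockResult (I : LatticeInstance) (hI : I.IsNonsingular) (t : Fin I.n → ℚ) {P : ℕ}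
    (w : Fin P → I.lattice) (hP : nVectors (m I.n) I.n ≤ P) (j : Fin (nBlk m I.n)) (r y : List Bool) :
    ((((Fin I.n → ZMod (q I.n)) × (Fin (m I.n) → (Fin I.n → ZMod (q I.n)) × ZMod (q I.n))) ×
        (Fin I.n → ZMod (q I.n))) ×
      (Fin (nVerify I.n) → (Fin I.n → ZMod (q I.n)) × ZMod (q I.n * schedK))) :=
  (((blockData q m a samp pc I hI t w hP j r).1, decodeSecret I.n (q I.n) y),
    (blockData q m a samp pc I hI t w hP j r).2)

/-- **What a reader gets off copy `j`'s output segment** `w = ⟨⟨(x ++ e_j) ++ c, y⟩, ε⟩ ++ junk`: the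
coins `c` (after the `|x| + K` known leading bits of the first field) and the oracle register `y`, hence
block `j`'s result. A mathematical reader (no complexity constraint). [folklore] -/
def readSeg (I : LatticeInstance) (hI : I.IsNonsingular) (t : Fin I.n → ℚ) {P : ℕ}
    (w : Fin P → I.lattice) (hP : nVectors (m I.n) I.n ≤ P) (xlen K : ℕ) (j : Fin (nBlk m I.n))
    (σ : List Bool) :=
  blockResult q m a samp pc I hI t w hP j ((fstF (fstF σ)).drop (xlen + K)) (sndF (fstF σ))

/-- **The digit table of an optional secret** (`none ↦` the table of `0`), `n · size q` bits.
[cite: RegevLWE2009, §3.2.1 ("outputs L⁻¹κ_L(x) mod p")] -/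
def optTable (p n : ℕ) (o : Option (Fin n → ZMod p)) : List Bool :=
  CVPOracle.table (Nat.size p) fun i => ((o.getD 0) i).val

/-- The table has `n · size p` bits. [folklore] -/
theorem length_optTable (p n : ℕ) (o : Option (Fin n → ZMod p)) : (optTable p n o).length = n * Nat.size p := by
  unfold optTable CVPOracle.table
  rw [List.length_flatten, List.map_ofFn]
  simp [Function.comp_def]

/-- On `some c` the table is the digit table of `c`. [folklore] -/
theorem optTable_some (p n : ℕ) (c : Fin n → ZMod p) :
    optTable p n (some c) = CVPOracle.table (Nat.size p) fun i => (c i).val := rfl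

/-- **The width-`b` block of copy `j` in the output of the indexed copies** (polynomial layout only:
`b = nIn + p_F(nIn) + 2` bits from position `blk j 0`; the copy's measured segment is a prefix of it, the
rest is padding). This is what a polynomial-time post-processing can locate without knowing the block
family's ancilla count. [cite: BennettBernsteinBrassardVazirani1997, Thm. 4.14 (proof: layout of the copies)] -/
def blockStr (Pc : PolyCopies.Params) (n : ℕ) (y : List Bool) (j : ℕ) : List Bool :=
  (y.drop (PolyCopiesIdx.blk Pc n j 0)).take (PolyCopiesIdx.b Pc n)

/-- The measured segment of copy `j` is a prefix of its width-`b` block. [folklore] -/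
theorem segment_prefix_blockStr (Pc : PolyCopies.Params) (n : ℕ) (y : List Bool) (j : ℕ) :
    PolyCopiesIdx.segment Pc n y j <+: blockStr Pc n y j := by
  have hle : PolyCopiesIdx.nIn Pc n + Pc.F.ancillas (PolyCopiesIdx.nIn Pc n) ≤ PolyCopiesIdx.b Pc n := by
    have := Pc.hpF (PolyCopiesIdx.nIn Pc n); unfold PolyCopiesIdx.b; omega
  rw [PolyCopiesIdx.segment, blockStr, ← min_eq_left hle, ← List.take_take]
  exact List.take_prefix _ _

/-- **The post-processing's value**: the digit table of the first accepted block's candidate.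
[cite: RegevLWE2009, Lemma 3.7 (proof); Regev2009, §3.2.1] -/
def postOut (n : ℕ)
    (v : Fin (nBlk m n) → ((((Fin n → ZMod (q n)) × (Fin (m n) → (Fin n → ZMod (q n)) × ZMod (q n))) ×
        (Fin n → ZMod (q n))) × (Fin (nVerify n) → (Fin n → ZMod (q n)) × ZMod (q n * schedK)))) :
    List Bool :=
  optTable (q n) n (firstAcceptedK (q n) schedK (m n) (nVerify n) (accTest (q n) (nVerify n) (α n)) v)

/-- **The query string of the instance** (as in A_plumb). [cite: RegevLWE2009, Lemma 3.11 (proof)] -/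
abbrev queryOf (I : LatticeInstance) (ρ : ℚ) (k : ℕ) (t : Fin I.n → ℚ) {P : ℕ} (w : Fin P → I.lattice) :
    List Bool :=
  query I ρ k (encBatch I.n P fun i => I.intCoords (w i)) t

/-- **The two classical programs of Regev's CVP_q machine, with their semantics** (what remains to be
BUILT for A_plumb; everything quantum / probabilistic is assembled from them below):
* `manuf ∈ FP` — on `(x ++ e_j) ++ c` (`x` the query string, `e_j ∈ {0,1}^{pK(|x|)+1}` one-hot, `c` the
  coins) it writes block `j`'s oracle input `blockInput … j c`;
* `post P ∈ FP` for every layout `P` of copies with `P.pK = pK` — on `⟨x, y⟩` it writes the digit table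
  `postOut` of the block results read off the first `nBlk` width-`b` blocks `blockStr P |x| y j` of `y`
  (polynomial layout; the reader `readSeg` only looks at the self-delimited tag at the block's start);
* the copies polynomial affords `nBlk(n) ≤ pK(|x|) + 1` blocks and the coin polynomial affords
  `blockCoins_j ≤ pcoin(|x ++ e_j|)` coins.
[cite: RegevLWE2009, Lemma 3.11 (proof: "efficient"), Lemma 3.7 (proof), §3.2.1] -/
structure CVPqPrograms (W : UniformQCircuitFamily) where
  /-- copies polynomial: `pK(|x|) + 1` parallel blocks -/
  pK : Polynomial ℕ
  /-- coins per block, as a polynomial of `|x ++ e_j|` -/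
  pcoin : Polynomial ℕ
  /-- the block manufacture -/
  manuf : List Bool → List Bool
  manuf_mem_FP : manuf ∈ FP
  /-- the layout-dependent post-processing -/
  post : PolyCopies.Params → List Bool → List Bool
  post_mem_FP : ∀ Pc : PolyCopies.Params, Pc.pK = pK → post Pc ∈ FP
  nBlk_le : ∀ (I : LatticeInstance) (ρ : ℚ) (k : ℕ) (t : Fin I.n → ℚ) (P : ℕ) (w : Fin P → I.lattice),
    nBlk m I.n ≤ pK.eval (queryOf I ρ k t w).length + 1
  coins_le : ∀ (I : LatticeInstance) (ρ : ℚ) (k : ℕ) (t : Fin I.n → ℚ) (P : ℕ) (w : Fin P → I.lattice)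
    (j : Fin (nBlk m I.n)),
    blockCoins (n := I.n) (m I.n) (nVerify I.n) pc (q I.n * denom t)
        (padVar (a I.n) (nLevels (m I.n)) (schedJ I.n) j) I.n (q I.n * schedK * denom t) ((a I.n) ^ 2 / 2) I.n
        (Nat.size (q I.n) + I.n) ≤
      pcoin.eval ((queryOf I ρ k t w).length + (pK.eval (queryOf I ρ k t w).length + 1))
  manuf_spec : ∀ (I : LatticeInstance) (hI : I.IsNonsingular) (ρ : ℚ) (k : ℕ) (t : Fin I.n → ℚ) (P : ℕ)
    (w : Fin P → I.lattice) (hP : nVectors (m I.n) I.n ≤ P) (j : Fin (nBlk m I.n)) (c : List Bool),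
    c.length = pcoin.eval ((queryOf I ρ k t w).length + (pK.eval (queryOf I ρ k t w).length + 1)) →
    manuf ((queryOf I ρ k t w ++ List.ofFn fun j' : Fin (pK.eval (queryOf I ρ k t w).length + 1) =>
        decide ((j' : ℕ) = (j : ℕ))) ++ c) = blockInput q m a samp pc I hI t w hP j c
  post_spec : ∀ (Pc : PolyCopies.Params), Pc.pK = pK →
    ∀ (I : LatticeInstance) (hI : I.IsNonsingular) (ρ : ℚ) (k : ℕ) (t : Fin I.n → ℚ) (P : ℕ)
      (w : Fin P → I.lattice) (hP : nVectors (m I.n) I.n ≤ P) (y : List Bool),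
      post Pc (boolPair (queryOf I ρ k t w) y) =
        postOut q α m I.n fun j => readSeg q m a samp pc I hI t w hP (queryOf I ρ k t w).length
          (pK.eval (queryOf I ρ k t w).length + 1) j
          (blockStr Pc (queryOf I ρ k t w).length y j)

end Instance

end Regev2009

/-! ### Indexed readers for the parallel copies (the block reader knows its block index) -/

namespace QWrap

open _root_.Computability Complexity QuantumComplexity Literature.Probability.Distributions

/-- **Law of block-indexed readers off the segments of the indexed copies**: independent, block `j`
distributed as `(F.kernel (x ++ e_j)).map (readB j)`. [cite: BennettBernsteinBrassardVazirani1997, Thm. 4.14 (proof); NielsenChuang2010, §2.2.8] -/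
theorem polyCopiesIdx_kernel_map_readIdx {β : Type} (P : PolyCopies.Params) (hfree : P.F.IsOracleFree)
    (hU : P.F.IsUniform) (x : List Bool) (readB : Fin (PolyCopiesIdx.K P x.length) → List Bool → β) :
    ((polyCopiesIdx P hfree hU).kernel x).map
        (fun w => fun j : Fin (PolyCopiesIdx.K P x.length) => readB j (PolyCopiesIdx.segment P x.length w j)) =
      indepLaw (PolyCopiesIdx.K P x.length) fun j =>
        (P.F.kernel 0 (PolyCopiesIdx.inputIdx P x j)).map (readB j) := by
  have hfun : (fun w : List Bool => fun j : Fin (PolyCopiesIdx.K P x.length) =>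
      readB j (PolyCopiesIdx.segment P x.length w j)) =
      (fun v : Fin (PolyCopiesIdx.K P x.length) → List Bool => fun j => readB j (v j)) ∘
        fun w => fun j : Fin (PolyCopiesIdx.K P x.length) => PolyCopiesIdx.segment P x.length w j := rfl
  show ((PolyCopiesIdx.family P).kernel 0 x).map _ = _
  rw [hfun, ← PMF.map_comp, PolyCopiesIdx.kernel_map_segments]
  exact (indepLaw_map_pi _ _ readB).trans
    (congrArg (indepLaw _) (funext fun j => by rw [PolyCopiesIdx.blockLaw_eq_kernel]))

/-- **Parallel copies + classical post-processing with block-indexed readers, LAW form.**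
[cite: BennettBernsteinBrassardVazirani1997, Thm. 4.14 (proof); BernsteinVazirani1997, §8] -/
theorem exists_copies_post_law_idx (P : PolyCopies.Params) (hfree : P.F.IsOracleFree) (hU : P.F.IsUniform)
    {g : List Bool → List Bool} (hg : g ∈ FP) :
    ∃ T : UniformQCircuitFamily, ∀ {β γ : Type} (x : List Bool)
      (readB : Fin (PolyCopiesIdx.K P x.length) → List Bool → β)
      (post : (Fin (PolyCopiesIdx.K P x.length) → β) → γ) (read : List Bool → γ),
      (∀ y ∈ ((polyCopiesIdx P hfree hU).kernel x).support, ∀ w : List Bool, g (boolPair x y) <+: w →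
          read w = post fun j => readB j (PolyCopiesIdx.segment P x.length y j)) →
        (T.kernel x).map read =
          (indepLaw (PolyCopiesIdx.K P x.length) fun j =>
              (P.F.kernel 0 (PolyCopiesIdx.inputIdx P x j)).map (readB j)).map post := by
  obtain ⟨T, hT⟩ := exists_cwrap_law (h := fun w : List Bool => w) (PolyTimeComputable.id _) hg
    (polyCopiesIdx P hfree hU)
  refine ⟨T, fun x readB post read hR => ?_⟩
  rw [hT x read (fun y => post fun j => readB j (PolyCopiesIdx.segment P x.length y j)) hR,
    ← polyCopiesIdx_kernel_map_readIdx P hfree hU x readB, PMF.map_comp]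
  rfl

end QWrap

/-! ### The assembly: A_plumb from the two programs -/

section Assembly

open _root_.Computability Literature.Computability.Complexity Literature.Computability.Complexity.CodeFP
  Literature.Computability.Complexity.Brick Literature.Computability.QuantumComplexity
  Literature.Algebra.EuclideanLattices Regev2009 Regev2009.DigitOracle Peikert2009 LWE
  Literature.Probability.Distributions

variable (q : ℕ → ℕ) [∀ n, NeZero (q n)] (α : ℕ → ℝ)

/-- **The law of Regev's CVP_q machine assembled from the programs.** From `CVPqPrograms` build
`T := CWrap(post) ∘ PolyCopiesIdx ∘ CoinCWrap(manuf, tag) ∘ W`; then on the query string of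
`(I, ρ, k, t, batch)` the first `n · size q` output bits of `T` are distributed EXACTLY as the digit table
of `DigitOracle.condExpS` run with the oracle `W.searchLWESolver` and the machine's sampler laws
(`shiftLawBits`, `sampLaw samp p_c …`). [cite: RegevLWE2009, Lemma 3.11 (proof) with Lemmas 3.7, 4.1
(proofs), §3.2.1; BennettBernsteinBrassardVazirani1997, Thm. 4.14; BernsteinVazirani1997, §8] -/
theorem Regev2009.cvpqMachine_law_of_programs (m : ℕ → ℕ) (a : ℕ → ℚ) (samp : List Bool → List Bool)
    (pc : Polynomial ℕ) (W : UniformQCircuitFamily) (prog : CVPqPrograms q α m a samp pc W) :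
    ∃ T : UniformQCircuitFamily, ∀ (I : LatticeInstance) (hI : I.IsNonsingular) (ρ : ℚ) (k : ℕ)
      (t : Fin I.n → ℚ) (P : ℕ) (w : Fin P → I.lattice) (hP : nVectors (m I.n) I.n ≤ P),
      (T.kernel (queryOf I ρ k t w)).map (fun σ => σ.take (I.n * Nat.size (q I.n))) =
        (condExpS (q I.n) (m I.n) (α I.n) I hI (W.searchLWESolver I.n (q I.n) (m I.n)) t w hP
            (shiftLawBits I.n (q I.n) (Nat.size (q I.n) + I.n))
            (fun j => sampLaw samp pc (q I.n * denom t) (padVar (a I.n) (nLevels (m I.n)) (schedJ I.n) j) I.n)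
            (sampLaw samp pc (q I.n * schedK * denom t) ((a I.n) ^ 2 / 2) I.n)).map (optTable (q I.n) I.n) := by
  classical
  -- the block family: coins, manufacture, oracle, self-delimiting tag
  obtain ⟨T₁, hT₁⟩ := QWrap.exists_coin_cwrap_law prog.manuf_mem_FP tagNil_mem_FP W prog.pcoin
  -- the layout of its parallel indexed copies
  obtain ⟨pF, hpF⟩ := QCircuitFamily.IsUniform.isPolySize_holds T₁.isUniform
  let Pc : PolyCopies.Params := ⟨T₁.family, pF, fun n => (hpF n).2, prog.pK⟩
  have hPc : Pc.pK = prog.pK := rfl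
  -- copies + post-processing
  obtain ⟨T, hT⟩ := QWrap.exists_copies_post_law_idx Pc T₁.isOracleFree T₁.isUniform (prog.post_mem_FP Pc hPc)
  refine ⟨T, fun I hI ρ k t P w hP => ?_⟩
  set x := queryOf I ρ k t w with hx
  have hK : nBlk m I.n ≤ PolyCopiesIdx.K Pc x.length := prog.nBlk_le I ρ k t P w
  -- the block-indexed reader (junk beyond the blocks that are read)
  let readB : Fin (PolyCopiesIdx.K Pc x.length) → List Bool → _ := fun j σ =>
    if h : (j : ℕ) < nBlk m I.n then readSeg q m a samp pc I hI t w hP x.length (prog.pK.eval x.length + 1) ⟨j, h⟩ σ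
    else readSeg q m a samp pc I hI t w hP x.length (prog.pK.eval x.length + 1) ⟨0, nBlk_pos m I.n⟩ σ
  have hrb : ∀ j : Fin (nBlk m I.n), readB (Fin.castLE hK j) =
      readSeg q m a samp pc I hI t w hP x.length (prog.pK.eval x.length + 1) j := by
    intro j; funext σ; simp [readB]
  -- the programs' specifications at this query string
  have mspec : ∀ (j : Fin (nBlk m I.n)) (c : List Bool),
      c.length = prog.pcoin.eval (x.length + (prog.pK.eval x.length + 1)) →
      prog.manuf ((x ++ List.ofFn fun j' : Fin (prog.pK.eval x.length + 1) => decide ((j' : ℕ) = (j : ℕ))) ++ c) =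
        blockInput q m a samp pc I hI t w hP j c := by
    rw [hx]; exact prog.manuf_spec I hI ρ k t P w hP
  have pspec : ∀ y : List Bool, prog.post Pc (boolPair x y) =
      postOut q α m I.n fun j => readSeg q m a samp pc I hI t w hP x.length (prog.pK.eval x.length + 1) j
        (blockStr Pc x.length y j) := by
    rw [hx]; exact prog.post_spec Pc hPc I hI ρ k t P w hP
  -- support facts: every segment of an output of the copies is an output of the block family, and every
  -- output of the block family starts with the self-delimiting tag
  have hsuppT₁ : ∀ (x' : List Bool), ∀ σ ∈ (T₁.kernel x').support, ∃ z : List Bool, tagNil z <+: σ := by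
    intro x' σ hσ
    have hlaw := hT₁ x' (fun σ => (∃ z : List Bool, tagNil z <+: σ : Prop)) (fun _ _ => True)
      (fun c y _ w'' hpre => eq_true ⟨_, hpre⟩)
    have hmem : (∃ z : List Bool, tagNil z <+: σ) ∈
        ((T₁.kernel x').map fun σ => (∃ z : List Bool, tagNil z <+: σ : Prop)).support :=
      (PMF.mem_support_map_iff _ _ _).2 ⟨σ, hσ, rfl⟩
    rw [hlaw] at hmem
    obtain ⟨c, -, hc⟩ := (PMF.mem_support_bind_iff _ _ _).1 hmem
    obtain ⟨y, -, hy⟩ := (PMF.mem_support_map_iff _ _ _).1 hc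
    exact of_eq_true hy.symm
  have hsegsupp : ∀ y ∈ ((QWrap.polyCopiesIdx Pc T₁.isOracleFree T₁.isUniform).kernel x).support,
      ∀ j : Fin (PolyCopiesIdx.K Pc x.length),
        PolyCopiesIdx.segment Pc x.length y j ∈ (T₁.kernel (PolyCopiesIdx.inputIdx Pc x j)).support := by
    intro y hy j
    have hmem : (fun j : Fin (PolyCopiesIdx.K Pc x.length) => PolyCopiesIdx.segment Pc x.length y j) ∈
        (((PolyCopiesIdx.family Pc).kernel 0 x).map fun w => fun j : Fin (PolyCopiesIdx.K Pc x.length) =>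
          PolyCopiesIdx.segment Pc x.length w j).support :=
      (PMF.mem_support_map_iff _ _ _).2 ⟨y, hy, rfl⟩
    rw [PolyCopiesIdx.kernel_map_segments, PMF.mem_support_iff, indepLaw_apply, Finset.prod_ne_zero_iff] at hmem
    have h := hmem j (Finset.mem_univ j)
    rw [PolyCopiesIdx.blockLaw_eq_kernel] at h
    exact (PMF.mem_support_iff _ _).2 h
  have hC : ∀ j : Fin (nBlk m I.n),
      blockCoins (n := I.n) (m I.n) (nVerify I.n) pc (q I.n * denom t)
          (padVar (a I.n) (nLevels (m I.n)) (schedJ I.n) j) I.n (q I.n * schedK * denom t) ((a I.n) ^ 2 / 2) I.n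
          (Nat.size (q I.n) + I.n) ≤
        prog.pcoin.eval (x.length + (prog.pK.eval x.length + 1)) := by
    rw [hx]; exact prog.coins_le I ρ k t P w
  -- the reader hypothesis of the post-processing: its output IS the table, of the right length
  have hread : ∀ y ∈ ((QWrap.polyCopiesIdx Pc T₁.isOracleFree T₁.isUniform).kernel x).support, ∀ w' : List Bool,
      prog.post Pc (boolPair x y) <+: w' →
        (fun σ : List Bool => σ.take (I.n * Nat.size (q I.n))) w' =
          (fun v : Fin (PolyCopiesIdx.K Pc x.length) → _ => postOut q α m I.n fun j => v (Fin.castLE hK j))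
            (fun j => readB j (PolyCopiesIdx.segment Pc x.length y j)) := by
    intro y hy w' hpre
    obtain ⟨r, rfl⟩ := hpre
    have hfst : ∀ j : Fin (nBlk m I.n),
        fstF (blockStr Pc x.length y j) = fstF (PolyCopiesIdx.segment Pc x.length y j) := by
      intro j
      obtain ⟨z, hz⟩ := hsuppT₁ _ _ (hsegsupp y hy (Fin.castLE hK j))
      have hz' : tagNil z <+: PolyCopiesIdx.segment Pc x.length y j := hz
      rw [fstF_of_tagNil_prefix hz', fstF_of_tagNil_prefix (hz'.trans (segment_prefix_blockStr Pc x.length y j))]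
    have hlen := length_optTable (q I.n) I.n
      (firstAcceptedK (q I.n) schedK (m I.n) (nVerify I.n) (accTest (q I.n) (nVerify I.n) (α I.n)) fun j =>
        readSeg q m a samp pc I hI t w hP x.length (prog.pK.eval x.length + 1) j
          (blockStr Pc x.length y j))
    simp only [pspec y]
    rw [show I.n * Nat.size (q I.n) = (postOut q α m I.n fun j => readSeg q m a samp pc I hI t w hP x.length
        (prog.pK.eval x.length + 1) j (blockStr Pc x.length y j)).length from hlen.symm,
      take_length_append]
    refine congrArg (postOut q α m I.n) (funext fun j => ?_)
    rw [hrb j, Fin.val_castLE]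
    show blockResult q m a samp pc I hI t w hP j _ _ = blockResult q m a samp pc I hI t w hP j _ _
    rw [hfst j]
  rw [hT x readB (fun v => postOut q α m I.n fun j => v (Fin.castLE hK j)) _ hread]
  -- only the first `nBlk` blocks are read
  rw [show (fun v : Fin (PolyCopiesIdx.K Pc x.length) → _ => postOut q α m I.n fun j => v (Fin.castLE hK j)) =
      postOut q α m I.n ∘ (fun v => fun j : Fin (nBlk m I.n) => v (Fin.castLE hK j)) from rfl,
    ← PMF.map_comp, QWrap.indepLaw_map_castLE hK]
  -- the law of one block: coins → manufacture → oracle → reader = condBlockDataG >>= withAnswer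
  letI := I.isZLattice_of_isNonsingular hI
  have hblk : ∀ j : Fin (nBlk m I.n),
      (Pc.F.kernel 0 (PolyCopiesIdx.inputIdx Pc x (Fin.castLE hK j))).map (readB (Fin.castLE hK j)) =
        (condBlockDataG (zBasis I) (q I.n) schedK (m I.n) (nVerify I.n)
            (shiftLawBits I.n (q I.n) (Nat.size (q I.n) + I.n))
            (sampLaw samp pc (q I.n * denom t) (padVar (a I.n) (nLevels (m I.n)) (schedJ I.n) j) I.n)
            (sampLaw samp pc (q I.n * schedK * denom t) ((a I.n) ^ 2 / 2) I.n) (denom t) (numZ I t)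
            (blocksOf (nBlk m I.n) (m I.n + nVerify I.n) (fun i => w (Fin.castLE hP i)) j)).bind
          (withAnswer (q I.n) schedK (m I.n) (nVerify I.n) (W.searchLWESolver I.n (q I.n) (m I.n))) := by
    intro j
    have hin : PolyCopiesIdx.inputIdx Pc x (Fin.castLE hK j) =
        x ++ List.ofFn (fun j' : Fin (prog.pK.eval x.length + 1) => decide ((j' : ℕ) = (j : ℕ))) := rfl
    rw [hrb j, hin]
    generalize hx' : x ++ List.ofFn (fun j' : Fin (prog.pK.eval x.length + 1) => decide ((j' : ℕ) = (j : ℕ))) = x'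
    have hxl : x'.length = x.length + (prog.pK.eval x.length + 1) := by rw [← hx']; simp
    have hR : ∀ c : QReg (prog.pcoin.eval x'.length),
        ∀ y ∈ (W.kernel (prog.manuf (x' ++ List.ofFn c))).support, ∀ w'' : List Bool,
          tagNil (boolPair (x' ++ List.ofFn c) y) <+: w'' →
            readSeg q m a samp pc I hI t w hP x.length (prog.pK.eval x.length + 1) j w'' =
              blockResult q m a samp pc I hI t w hP j (List.ofFn c) y := by
      intro c y _ w'' hpre
      unfold readSeg
      rw [fstF_of_tagNil_prefix hpre, fstF_boolPair, sndF_boolPair, ← hxl, drop_length_append]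
    have h1 := hT₁ x' (readSeg q m a samp pc I hI t w hP x.length (prog.pK.eval x.length + 1) j)
      (fun c y => blockResult q m a samp pc I hI t w hP j (List.ofFn c) y) hR
    change (T₁.kernel x').map _ = _
    rw [h1]
    have h2 : (fun c : QReg (prog.pcoin.eval x'.length) =>
        (W.kernel (prog.manuf (x' ++ List.ofFn c))).map
          (fun y => blockResult q m a samp pc I hI t w hP j (List.ofFn c) y)) =
        fun c => withAnswer (q I.n) schedK (m I.n) (nVerify I.n) (W.searchLWESolver I.n (q I.n) (m I.n))
          (blockData q m a samp pc I hI t w hP j (List.ofFn c)) := by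
      funext c
      have hm : prog.manuf (x' ++ List.ofFn c) = blockInput q m a samp pc I hI t w hP j (List.ofFn c) := by
        have h := mspec j (List.ofFn c) (by rw [List.length_ofFn, ← hxl]); rw [hx'] at h; exact h
      rw [hm]
      simp only [blockInput, blockResult, withAnswer, UniformQCircuitFamily.searchLWESolver, PMF.map_comp,
        Function.comp_def]
    rw [h2, uniformQReg_bind_ofFn (prog.pcoin.eval x'.length) (fun cl =>
      withAnswer (q I.n) schedK (m I.n) (nVerify I.n) (W.searchLWESolver I.n (q I.n) (m I.n))
        (blockData q m a samp pc I hI t w hP j cl))]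
    have hC' : blockCoins (n := I.n) (m I.n) (nVerify I.n) pc (q I.n * denom t)
        (padVar (a I.n) (nLevels (m I.n)) (schedJ I.n) j) I.n (q I.n * schedK * denom t) ((a I.n) ^ 2 / 2) I.n
        (Nat.size (q I.n) + I.n) ≤ prog.pcoin.eval x'.length := by
      rw [hxl]; exact hC j
    exact uniformVector_bind_blockOfBits_withAnswer (zBasis I) (q I.n) schedK (m I.n) (nVerify I.n) samp pc
      (q I.n * denom t) (padVar (a I.n) (nLevels (m I.n)) (schedJ I.n) j) I.n (q I.n * schedK * denom t)
      ((a I.n) ^ 2 / 2) I.n (Nat.size (q I.n) + I.n) (denom t) (numZ I t)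
      (blocksOf (nBlk m I.n) (m I.n + nVerify I.n) (fun i => w (Fin.castLE hP i)) j) hC'
      (W.searchLWESolver I.n (q I.n) (m I.n))
  rw [show (fun j : Fin (nBlk m I.n) => (Pc.F.kernel 0 (PolyCopiesIdx.inputIdx Pc x (Fin.castLE hK j))).map
      (readB (Fin.castLE hK j))) = fun j => (condBlockDataG (zBasis I) (q I.n) schedK (m I.n) (nVerify I.n)
            (shiftLawBits I.n (q I.n) (Nat.size (q I.n) + I.n))
            (sampLaw samp pc (q I.n * denom t) (padVar (a I.n) (nLevels (m I.n)) (schedJ I.n) j) I.n)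
            (sampLaw samp pc (q I.n * schedK * denom t) ((a I.n) ^ 2 / 2) I.n) (denom t) (numZ I t)
            (blocksOf (nBlk m I.n) (m I.n + nVerify I.n) (fun i => w (Fin.castLE hP i)) j)).bind
          (withAnswer (q I.n) schedK (m I.n) (nVerify I.n) (W.searchLWESolver I.n (q I.n) (m I.n))) from funext hblk,
    show postOut q α m I.n = optTable (q I.n) I.n ∘
      firstAcceptedK (q I.n) schedK (m I.n) (nVerify I.n) (accTest (q I.n) (nVerify I.n) (α I.n)) from rfl,
    ← PMF.map_comp]
  simp only [condExpS]
  rfl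

/-- **A_plumb IS a theorem of the two programs.** Given, for all the data of
`regev2009_lemma_3_11_cvpqPlumbing`, the two classical programs with their semantics (`CVPqPrograms`),
the machine of `cvpqMachine_law_of_programs` satisfies A_plumb with `ν = 0`: the event "the digit table
of `c` is not a prefix of the output" has probability at most `P_{condExpS}[o ≠ some c]` (the first
`n · size q` output bits ARE distributed as the table of `condExpS`'s outcome, and `some c ↦ table c`).
HONEST FRAMING: a THEOREM reducing a named fact of a KNOWN reduction to the polynomial-time realisability of
two explicit string functions; not summit progress; breaks nothing.
[cite: RegevLWE2009, Lemma 3.11 (proof: "efficient algorithm"), §3.2.1; Goldreich2001, §3.2.1] -/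
theorem regev2009_lemma_3_11_cvpqPlumbing_of_programs
    (hprog : ∀ (m : ℕ → ℕ), IsPolyBounded m → IsPolyTimeParams q α m → ∀ (a : ℕ → ℚ), (∀ n, α n = a n) →
      PolyTimeComputable unaryEncodeNat encodeRat a → ∀ (samp : List Bool → List Bool) (pc : Polynomial ℕ),
      samp ∈ FP → ∀ W : UniformQCircuitFamily, Nonempty (CVPqPrograms q α m a samp pc W)) :
    regev2009_lemma_3_11_cvpqPlumbing q α := by
  intro m hm hpar a hα ha samp pc hsamp W
  obtain ⟨prog⟩ := hprog m hm hpar a hα ha samp pc hsamp W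
  obtain ⟨T, hT⟩ := cvpqMachine_law_of_programs q α m a samp pc W prog
  refine ⟨T, 0, isNegligible_zero, Filter.Eventually.of_forall fun n => ?_⟩
  intro I hI ρ k t P w hP c _
  rw [Pi.zero_apply, ENNReal.ofReal_zero, add_zero]
  have hTI := hT I hI ρ k t P w hP
  calc (T.kernel (Regev2009.queryOf I ρ k t w)).toOuterMeasure
          {σ | CVPOracle.table (Nat.size (q I.n)) (fun j => (c j).val) <+: σ}ᶜ
      ≤ (T.kernel (Regev2009.queryOf I ρ k t w)).toOuterMeasure
          ((fun σ : List Bool => σ.take (I.n * Nat.size (q I.n))) ⁻¹'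
            {l | l ≠ CVPOracle.table (Nat.size (q I.n)) fun j => (c j).val}) := by
        refine PMF.toOuterMeasure_mono _ fun σ hσ => ?_
        simp only [Set.mem_compl_iff, Set.mem_setOf_eq, Set.mem_inter_iff, Set.mem_preimage] at hσ ⊢
        intro heq
        exact hσ.1 (heq ▸ List.take_prefix _ σ)
    _ = ((condExpS (q I.n) (m I.n) (α I.n) I hI (W.searchLWESolver I.n (q I.n) (m I.n)) t w hP
            (shiftLawBits I.n (q I.n) (Nat.size (q I.n) + I.n))
            (fun j => sampLaw samp pc (q I.n * denom t) (padVar (a I.n) (nLevels (m I.n)) (schedJ I.n) j) I.n)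
            (sampLaw samp pc (q I.n * schedK * denom t) ((a I.n) ^ 2 / 2) I.n)).map (optTable (q I.n) I.n)).toOuterMeasure
          {l | l ≠ CVPOracle.table (Nat.size (q I.n)) fun j => (c j).val} := by
        rw [← hTI, PMF.toOuterMeasure_map_apply]
    _ ≤ _ := by
        rw [PMF.toOuterMeasure_map_apply]
        refine PMF.toOuterMeasure_mono _ fun o ho => ?_
        simp only [Set.mem_inter_iff, Set.mem_preimage, Set.mem_setOf_eq] at ho ⊢
        rintro rfl
        exact ho.1 (optTable_some (q I.n) I.n c)

end Assembly

end Literature.Computability.Cryptography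

end
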